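import Summits.Ventures.PercRepro0.TrifZero
import Summits.Ventures.PercRepro0.Tripod
import Summits.Ventures.PercRepro0.ExtTails

/-!
# Creating a trifurcation, and Theorem P3 (UNIQUENESS-p6-v1 §3.4, §4 Step 3(a), Step 4), seat p6

Kernel-checked twin, on `Defs.lean`, of the creation half of Step 3 of the uniqueness proof and of the
final assembly:

* Lemma 3.4 = `isTrif_of_tripod`: if the bonds of `ω'` meeting `Λ_n` are exactly those of a tripod
  (`Tripod.exists_tripod`) with tips `b` whose exterior clusters are infinite and pairwise disjoint
  (`ExtTails`' good event), the centre is a trifurcation (a closure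
  argument, `cluster_subset_of_closed`, on `B i` = the arm of `b i` without the centre, united with the
  exterior cluster of `b i`);
* Step 3(a) = `P_isTrif_zero_pos`: `P_p(N ≥ 3) > 0 ⇒ P_p(0 is a trifurcation) > 0` by finite energy
  (`FiniteEnergyDefs.finite_energy`) with the CONSTANT inside choice «exactly the tripod open» on one good
  face triple (`ExtTails.exists_good_pos`), and translation invariance (`Trif.P_isTrif_eq`);
* with `TrifZero.P_isTrif_zero_eq_zero` (the counting half, `TrifZero.lean` = the unimportable `TrifCount.lean`): `P_p(N ≥ 3) = 0` for every `p` (`P_atLeastInf_three_eq_zero'`;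
  the endpoints `p ∈ {0,1}` by the Dirac laws), hence `P3_Unique d` for every `d ≥ 1` (`P3_Unique_of_pos`,
  via `Merge.P3_Unique_of_no_three`) and for `d = 0` (`P3_Unique_zero`, one vertex):
  `P3_Unique_all : ∀ d, P3_Unique d` — Theorem P3 · UNIQUE, unconditional, standard axioms.
-/

namespace Summit.Ventures.PercRepro0.TrifCreate

open MeasureTheory ProbabilityTheory unitInterval Set Function
open scoped ENNReal
open Summit.Ventures.PercRepro0.Defs
open Summit.Ventures.PercRepro0.L2 (cylS extCfg mem_cylS)
open Summit.Ventures.PercRepro0.Merge (touching touching_finite P3_Unique_of_no_three bonds_mem_atMostOne)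
open Summit.Ventures.PercRepro0.Ergodic (atLeastInf measurableSet_atLeastInf)
open Summit.Ventures.PercRepro0.FiniteEnergyDefs (feConst feConst_pos finite_energy modified)
open Summit.Ventures.PercRepro0.Trif (closeAt IsTrif P_isTrif_eq)
open Summit.Ventures.PercRepro0.TrifZero (conn_closeAt_of_walk P_isTrif_zero_eq_zero)
open Summit.Ventures.PercRepro0.Tripod (exists_tripod)
open Summit.Ventures.PercRepro0.ExtTails (notMem_box_of_notMem_touching notMem_box_of_conn_ext
  conn_closeAt_of_conn_ext measurableSet_good good_of_sdiff_eq exists_good_pos)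

variable {d : ℕ}

/-! ## Lemma 3.4: the centre of the tripod is a trifurcation -/

/-- A set closed under open adjacency contains the clusters of its points. -/
theorem cluster_subset_of_closed {ω : Config d} {B : Set (Vertex d)}
    (hB : ∀ y ∈ B, ∀ y', (openGraph d ω).Adj y y' → y' ∈ B) {a : Vertex d} (ha : a ∈ B) :
    cluster d ω a ⊆ B := by
  intro c hc
  obtain ⟨w⟩ := hc
  induction w with
  | nil => exact ha
  | @cons u v c hadj w ih => exact ih (hB u ha v hadj)

/-- Lemma 3.4: let the bonds of `ω'` meeting `Λ_n` be exactly the bonds of a tripod with centre `v ∈ Λ_n`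
and tips `b i ∉ Λ_n` (three lattice paths `A i : v → b i`, vertices other than `b i` in `Λ_n`, pairwise
meeting only in `v`), and let the tips have infinite, pairwise disjoint exterior clusters. Then `v` is a
trifurcation of `ω'`. -/
theorem isTrif_of_tripod {n : ℕ} {b : Fin 3 → Vertex d} (hb : ∀ i, b i ∉ box d n)
    {v : Vertex d} (hv : v ∈ box d n) (A : ∀ i : Fin 3, (lattice d).Walk v (b i))
    (hpath : ∀ i, (A i).IsPath) (hbox : ∀ i, ∀ y ∈ (A i).support, y ≠ b i → y ∈ box d n)
    (hmeet : ∀ i j, i ≠ j → ∀ y, y ∈ (A i).support → y ∈ (A j).support → y = v)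
    {ω' : Config d} (hin : ∀ e ∈ touching d n, e ∈ ω' ↔ ∃ i, e ∈ (A i).edges)
    (hgood : ω' ∈ {ω : Config d | (∀ i, ConnInf d (ω \ touching d n) (b i)) ∧
      ∀ i j, i ≠ j → ¬ Conn d (ω \ touching d n) (b i) (b j)}) :
    IsTrif ω' v := by
  classical
  have hvb : ∀ i, v ≠ b i := fun i h => hb i (h ▸ hv)
  -- tripod bonds are bonds meeting `Λ_n`, hence open in `ω'`
  have hedge : ∀ i, ∀ e ∈ (A i).edges, e ∈ bonds d ∧ e ∈ touching d n := by
    intro i e he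
    have hbond : e ∈ bonds d := (A i).edges_subset_edgeSet he
    refine ⟨hbond, ?_⟩
    induction e using Sym2.ind with
    | h y y' =>
      have hy : y ∈ (A i).support := (A i).fst_mem_support_of_mem_edges he
      have hy' : y' ∈ (A i).support := (A i).snd_mem_support_of_mem_edges he
      have hyy' : y ≠ y' := ((A i).adj_of_mem_edges he).ne
      by_cases hyb : y = b i
      · have : y' ≠ b i := fun h => hyy' (hyb.trans h.symm)
        exact ⟨hbond, y', by simp, hbox i y' hy' this⟩
      · exact ⟨hbond, y, by simp, hbox i y hy hyb⟩
  have hopen : ∀ i, ∀ e ∈ (A i).edges, e ∈ ω' := fun i e he =>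
    (hin e (hedge i e he).2).2 ⟨i, he⟩
  -- the first step of each arm
  have hstep : ∀ i, ∃ (w : Vertex d) (h : (lattice d).Adj v w) (T : (lattice d).Walk w (b i)),
      A i = SimpleGraph.Walk.cons h T := fun i => SimpleGraph.Walk.exists_eq_cons_of_ne (hvb i) (A i)
  choose w hw T hT using hstep
  have hwsupp : ∀ i, w i ∈ (A i).support := fun i => by
    rw [hT i, SimpleGraph.Walk.support_cons]; exact List.mem_cons_of_mem _ (T i).start_mem_support
  have hvT : ∀ i, v ∉ (T i).support := fun i => by
    have := hpath i
    rw [hT i, SimpleGraph.Walk.cons_isPath_iff] at this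
    exact this.2
  have hwv : ∀ i, w i ≠ v := fun i h => hvT i (h ▸ (T i).start_mem_support)
  have hTedges : ∀ i, ∀ e ∈ (T i).edges, e ∈ (A i).edges := fun i e he => by
    rw [hT i, SimpleGraph.Walk.edges_cons]; exact List.mem_cons_of_mem _ he
  -- the arm beyond `v` joins `w i` to `b i` in `ω'^{(v)}`
  have harm : ∀ i, Conn d (closeAt ω' v) (w i) (b i) := by
    intro i
    have hTω : ∀ e ∈ (T i).edges, e ∈ (openGraph d ω').edgeSet := by
      intro e he
      rw [openGraph, SimpleGraph.edgeSet_fromEdgeSet]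
      exact ⟨⟨hopen i e (hTedges i e he), (hedge i e (hTedges i e he)).1⟩,
        SimpleGraph.not_isDiag_of_mem_edgeSet _ ((T i).edges_subset_edgeSet he)⟩
    refine conn_closeAt_of_walk ((T i).transfer (openGraph d ω') hTω) ?_
    rw [SimpleGraph.Walk.support_transfer]
    exact hvT i
  refine ⟨w, fun i => ?_, fun i => ?_, fun i j hij => ?_⟩
  · -- the bond `{v, w i}` is open
    have he : s(v, w i) ∈ (A i).edges := by
      rw [hT i, SimpleGraph.Walk.edges_cons]; exact List.mem_cons_self ..
    exact ⟨hopen i _ he, (hedge i _ he).1⟩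
  · -- the cluster of `w i` in `ω'^{(v)}` contains the exterior cluster of `b i`
    refine (hgood.1 i).mono fun y hy => ?_
    exact (harm i).trans (conn_closeAt_of_conn_ext hv hy)
  · -- separation: the cluster of `w i` in `ω'^{(v)}` lies in `B i`, which misses `w j`
    intro hc
    let B : Set (Vertex d) := {y | (y ∈ (A i).support ∧ y ≠ v) ∨ Conn d (ω' \ touching d n) (b i) y}
    have hclosed : ∀ y ∈ B, ∀ y', (openGraph d (closeAt ω' v)).Adj y y' → y' ∈ B := by
      intro y hy y' hadj
      rw [openGraph, SimpleGraph.fromEdgeSet_adj] at hadj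
      obtain ⟨⟨⟨hyω, hvnot⟩, hbond⟩, hyy'⟩ := hadj
      have hy'v : y' ≠ v := fun h => hvnot (by rw [h]; simp)
      by_cases htouch : s(y, y') ∈ touching d n
      · -- an inside bond: a bond of the arm `A i` (the arms meet only in `v`)
        obtain ⟨j, hj⟩ := (hin _ htouch).1 hyω
        have hyj : y ∈ (A j).support := (A j).fst_mem_support_of_mem_edges hj
        have hyi : y ∈ (A i).support ∧ y ≠ v := by
          rcases hy with hy | hy
          · exact hy
          · -- `y` is in the exterior cluster of `b i`: it is outside `Λ_n`, hence a tip, hence `b i`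
            have hynot : y ∉ box d n := notMem_box_of_conn_ext hy (hb i)
            have hyb : y = b j := by
              by_contra h
              exact hynot (hbox j y hyj h)
            have hji : j = i := by
              by_contra h
              exact hgood.2 i j (Ne.symm h) (hyb ▸ hy)
            subst hji
            exact ⟨hyb ▸ (A j).end_mem_support, hyb ▸ (hvb j).symm⟩
        have hji : j = i := by
          by_contra h
          exact hyi.2 (hmeet j i h y hyj hyi.1)
        subst hji
        exact Or.inl ⟨(A j).snd_mem_support_of_mem_edges hj, hy'v⟩
      · -- an exterior bond: `y` is outside `Λ_n`, so it is `b i` or already in the exterior cluster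
        have hext : Conn d (ω' \ touching d n) y y' := by
          refine SimpleGraph.Adj.reachable ?_
          rw [openGraph, SimpleGraph.fromEdgeSet_adj]
          exact ⟨⟨⟨hyω, htouch⟩, hbond⟩, hyy'⟩
        have hynot : y ∉ box d n := notMem_box_of_notMem_touching hbond htouch (by simp)
        rcases hy with hy | hy
        · have hyb : y = b i := by
            by_contra h
            exact hynot (hbox i y hy.1 h)
          exact Or.inr (hyb ▸ hext)
        · exact Or.inr (hy.trans hext)
    have hwB : w i ∈ B := Or.inl ⟨hwsupp i, hwv i⟩
    have hwjB : w j ∈ B := cluster_subset_of_closed hclosed hwB hc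
    rcases hwjB with h | h
    · exact hwv j (hmeet j i (Ne.symm hij) (w j) (hwsupp j) h.1)
    · have hnot : w j ∉ box d n := notMem_box_of_conn_ext h (hb i)
      have hwb : w j = b j := by
        by_contra h'
        exact hnot (hbox j (w j) (hwsupp j) h')
      exact hgood.2 i j hij (hwb ▸ h)

/-! ## Step 3(a) and Theorem P3 -/

/-- Step 3(a): for `0 < p < 1`, `P_p(N ≥ 3) > 0` forces `P_p(0 is a trifurcation) > 0`. -/
theorem P_isTrif_zero_pos {p : I} (hp0 : (0 : ℝ) < p) (hp1 : (p : ℝ) < 1)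
    (h3 : 0 < P d p (atLeastInf d 3)) : 0 < P d p {ω : Config d | IsTrif ω 0} := by
  classical
  obtain ⟨n, b, hface, hgood⟩ := exists_good_pos h3
  choose u hu hadj using fun i => (hface.1 i).2
  obtain ⟨v, hv, A, hpath, hbox, hmeet⟩ :=
    exists_tripod b u hu (fun i => (hface.1 i).1) hadj hface.2
  -- finite energy with the constant inside choice «exactly the tripod open»
  set F : Finset (Sym2 (Vertex d)) := (touching_finite (d := d) n).toFinset with hFdef
  have hmemF : ∀ e, e ∈ F ↔ e ∈ touching d n := fun e => (touching_finite n).mem_toFinset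
  have hFb : ∀ e ∈ F, e ∈ bonds d := fun e he => ((hmemF e).1 he).1
  let η : F → Bool := fun e => decide (∃ i, (e : Sym2 (Vertex d)) ∈ (A i).edges)
  have key := finite_energy p F hFb (measurableSet_good n b) (fun _ => η) fun ξ => by
    by_cases h : η = ξ
    · simp only [h, Set.setOf_true]
      exact MeasurableSet.univ
    · simp only [h, Set.setOf_false]
      exact MeasurableSet.empty
  have hpos : 0 < feConst p ^ F.card *
      P d p {ω : Config d | (∀ i, ConnInf d (ω \ touching d n) (b i)) ∧
      ∀ i j, i ≠ j → ¬ Conn d (ω \ touching d n) (b i) (b j)} :=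
    ENNReal.mul_pos (pow_ne_zero _ (feConst_pos hp0 hp1).ne') hgood.ne'
  rw [← P_isTrif_eq p v]
  refine lt_of_lt_of_le (lt_of_lt_of_le hpos key) (measure_mono ?_)
  rintro ω' ⟨hcyl, ξ, hξ⟩
  refine isTrif_of_tripod (fun i => (hface.1 i).1) hv A hpath hbox hmeet ?_ ?_
  · intro e he
    have h := mem_cylS.1 hcyl ⟨e, (hmemF e).2 he⟩
    simpa [η] using h
  · refine good_of_sdiff_eq ?_ hξ
    ext e
    simp only [Set.mem_sdiff, Set.mem_union, Finset.mem_coe]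
    constructor
    · rintro ⟨h1 | ⟨h2, _⟩, h3⟩
      · exfalso
        obtain ⟨hF, _⟩ := h1
        exact h3 ((hmemF e).1 hF)
      · exact ⟨h2, h3⟩
    · rintro ⟨h1, h2⟩
      exact ⟨Or.inr ⟨h1, fun h => h2 ((hmemF e).1 h)⟩, h2⟩

/-- Step 3: for `0 < p < 1`, `P_p(N ≥ 3) = 0`. -/
theorem P_atLeastInf_three_eq_zero {p : I} (hp0 : (0 : ℝ) < p) (hp1 : (p : ℝ) < 1) :
    P d p (atLeastInf d 3) = 0 := by
  by_contra h
  have := P_isTrif_zero_pos hp0 hp1 (pos_iff_ne_zero.2 h)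
  rw [P_isTrif_zero_eq_zero] at this
  exact lt_irrefl _ this

/-- The empty configuration has no three infinite clusters. -/
theorem empty_notMem_atLeastInf_three : (∅ : Config d) ∉ atLeastInf d 3 := by
  rintro ⟨x, hx, -⟩
  apply hx 0
  rw [cluster_empty]
  exact Set.finite_singleton _

/-- The full lattice has no three (distinct) infinite clusters. -/
theorem bonds_notMem_atLeastInf_three : bonds d ∉ atLeastInf d 3 := by
  rintro ⟨x, hx, hxx⟩
  exact hxx 0 1 (by decide) (bonds_mem_atMostOne (x 0) (x 1) (hx 0) (hx 1))

/-- `P_p(N ≥ 3) = 0` for every `p ∈ [0,1]` (the endpoints by the Dirac laws). -/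
theorem P_atLeastInf_three_eq_zero' (p : I) : P d p (atLeastInf d 3) = 0 := by
  rcases eq_or_lt_of_le p.2.1 with hp0 | hp0
  · have : p = 0 := Subtype.ext hp0.symm
    subst this
    show setBernoulli (bonds d) 0 (atLeastInf d 3) = 0
    rw [setBernoulli_zero, Measure.dirac_apply' _ (measurableSet_atLeastInf 3),
      Set.indicator_of_notMem empty_notMem_atLeastInf_three]
  rcases eq_or_lt_of_le p.2.2 with hp1 | hp1
  · have : p = 1 := Subtype.ext hp1
    subst this
    show setBernoulli (bonds d) 1 (atLeastInf d 3) = 0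
    rw [setBernoulli_one, Measure.dirac_apply' _ (measurableSet_atLeastInf 3),
      Set.indicator_of_notMem bonds_notMem_atLeastInf_three]
  exact P_atLeastInf_three_eq_zero hp0 hp1

/-- Theorem P3 · UNIQUE for every `d ≥ 1`: a.s. at most one infinite open cluster, for every `p`. -/
theorem P3_Unique_of_pos (hd : 1 ≤ d) : P3_Unique d :=
  P3_Unique_of_no_three hd fun p => P_atLeastInf_three_eq_zero' p

/-- `d = 0`: the lattice has a single vertex, so no cluster is infinite. -/
theorem P3_Unique_zero : P3_Unique 0 := by
  intro p
  have : atMostOneInfCluster 0 = Set.univ := by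
    ext ω
    simp only [Set.mem_univ, iff_true]
    intro x _ hx _
    exact absurd (Set.toFinite _) hx
  rw [this, measure_univ]

/-- Theorem P3 · UNIQUE in every dimension. -/
theorem P3_Unique_all : ∀ d : ℕ, P3_Unique d := by
  intro d
  rcases Nat.eq_zero_or_pos d with h | h
  · subst h
    exact P3_Unique_zero
  · exact P3_Unique_of_pos h

end Summit.Ventures.PercRepro0.TrifCreate
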